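import Mathlib
import Summits.NavierStokesRegularity.NavierStokesRegularity.Theorems.EulerZoomLiouvillePowerGaugeEulerLiouvilleSwirlfreeLedgerDecay
import Literature.Analysis.FluidPDE.AncientMildWeakStar
import Literature.Analysis.FluidPDE.SqIntegralBalance
import Literature.Analysis.FluidPDE.ClassicalSolution
import Literature.Analysis.FluidPDE.AxisymmetricEuler
import Literature.Analysis.FluidPDE.VorticityCalculus
import HarnessLib

/-!
# Crux `EulerZoomLiouville.PowerGaugeEulerLiouville` (stmt-NavierStokesRegularity-19832), line `casimir-floor`, stub K3 — part 1:
# TOOLS FOR THE FLOOR ENDGAME (an off-axis blob of positive ledger mass; the windowed enstrophy budget; `log a = o(a^ε)`)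

Route №10 `EulerZoomLiouville` (NavierStokesRegularity), crux E.  Line `casimir-floor` (ideator ns-idea-11 g3;
`Cruxes/PowerGaugeEulerLiouville/Lines/casimir_floor.lean`), registered stub `stub_floorEndgame` (K3).  This file supplies the three
self-contained ingredients of its proof (part 2, `…CasimirFloorEndgame`, assembles them):

* `exists_offAxis_of_curl_ne_zero` — if the (continuous) vorticity of a slice is not identically zero, it is non-zero at a point
  OFF the symmetry axis (the axis is a null set, `volume_setOf_cylRadius_eq_zero`, and cannot contain the open set `{curl v ≠ 0}`);
* `exists_blob_of_curl_ne_zero` — around such a point there is a LEDGER BLOB: a ball `B(x₀, δ)`, `0 < δ < r(x₀)`, a bound `W > 0` with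
  `|curl v| / r ≤ W` on it, and a mass `m > 0` with `m ≤ ∫_{B(x₀,δ)} |curl v| / r` (continuity of `|curl v| / r` off the axis);
* `lintegral_window_sq_curl_le` — the `E`-gauge of a classical member bounds the windowed enstrophy:
  `∫_{−a²}^{0} ∫_{B(0,a)} |curl u|² ≤ 16 c a^{1−ρ}` (`|curl u|² ≤ 16 |∇u|²_F`, `sq_norm_curl_le_frobeniusNormSq`, and the gauge read on the
  classical gradient, `setLIntegral_window_frobenius_fderiv_le`, both from the sibling line `swirlfree-ledger`);
* `eventually_mul_log_lt_rpow` — `K log a < a^ε` for all large `a` (`ε > 0`; Mathlib `isLittleO_log_rpow_atTop`).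

WHAT THIS IS NOT: not NS, not the crux — helper lemmas `--supports` stmt-19832 on the line `casimir-floor` (a stratum statement about a
hypothetical Euler zoom-limit class); no summit statement is proved here and nothing here bears on NS regularity itself.  [folklore]
-/

noncomputable section

-- flat `Theorems/<Route><Decl>…` files of one crux share the namespace of the crux (tree convention)
set_option linter.dupNamespace false

open MeasureTheory Set Filter Topology Metric Function Asymptotics
open scoped NNReal ENNReal

namespace Summit.NavierStokesRegularity.NavierStokesRegularity.Theorems.PowerGaugeEulerLiouville.CasimirFloor

open Literature.Analysis Literature.Analysis.FluidPDE
open Summit.NavierStokesRegularity.NavierStokesRegularity.Theorems.PowerGaugeEulerLiouville.SwirlfreeLedger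

variable {u : ℝ → EuclideanSpace ℝ (Fin 3) → EuclideanSpace ℝ (Fin 3)} {p : ℝ → EuclideanSpace ℝ (Fin 3) → ℝ}
  {H : ℝ → EuclideanSpace ℝ (Fin 3) → EuclideanSpace ℝ (Fin 3) →L[ℝ] EuclideanSpace ℝ (Fin 3)}

/-! ### An off-axis point of non-zero vorticity -/

/-- **A non-zero continuous vorticity is non-zero somewhere off the axis**: the open non-empty set `{curl v ≠ 0}` has positive
measure, the symmetry axis `{r = 0}` is null (`volume_setOf_cylRadius_eq_zero`). [folklore] -/
theorem exists_offAxis_of_curl_ne_zero {v : EuclideanSpace ℝ (Fin 3) → EuclideanSpace ℝ (Fin 3)} (hv : Continuous (curl v))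
    {x₁ : EuclideanSpace ℝ (Fin 3)} (hx₁ : curl v x₁ ≠ 0) :
    ∃ x₀ : EuclideanSpace ℝ (Fin 3), cylRadius x₀ ≠ 0 ∧ curl v x₀ ≠ 0 := by
  by_contra hcon
  push Not at hcon
  have hO : IsOpen {x : EuclideanSpace ℝ (Fin 3) | curl v x ≠ 0} := isOpen_ne_fun hv continuous_const
  have hsub : {x : EuclideanSpace ℝ (Fin 3) | curl v x ≠ 0} ⊆ {x | cylRadius x = 0} := by
    intro x hx
    by_contra hr
    exact hx (hcon x hr)
  have hpos : 0 < volume {x : EuclideanSpace ℝ (Fin 3) | curl v x ≠ 0} := hO.measure_pos volume ⟨x₁, hx₁⟩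
  exact hpos.ne' (measure_mono_null hsub volume_setOf_cylRadius_eq_zero)

/-! ### A ledger blob of positive mass -/

/-- **A ledger blob around an off-axis point of non-zero vorticity.**  If `curl v` is continuous, `r(x₀) ≠ 0` and `curl v x₀ ≠ 0`,
there are `0 < δ < r(x₀)`, `W > 0`, `m > 0` with `|curl v| / r ≤ W` on `B(x₀, δ)` and `m ≤ ∫_{B(x₀,δ)} |curl v| / r`
(take `δ = r(x₀)/2`, so `r > r(x₀)/2` on the ball; `W` from a bound of `|curl v|` on the closed ball; `m` = the (finite, positive) mass
itself, positive because `|curl v|/r` is continuous and positive at `x₀`). [folklore] -/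
theorem exists_blob_of_curl_ne_zero {v : EuclideanSpace ℝ (Fin 3) → EuclideanSpace ℝ (Fin 3)} (hv : Continuous (curl v))
    {x₀ : EuclideanSpace ℝ (Fin 3)} (hx₀ : cylRadius x₀ ≠ 0) (hc : curl v x₀ ≠ 0) :
    ∃ δ W m : ℝ, 0 < δ ∧ δ < cylRadius x₀ ∧ 0 < W ∧ 0 < m ∧
      (∀ x ∈ ball x₀ δ, ‖curl v x‖ / cylRadius x ≤ W) ∧
      ENNReal.ofReal m ≤ ∫⁻ x in ball x₀ δ, ENNReal.ofReal (‖curl v x‖ / cylRadius x) := by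
  have hr₀ : 0 < cylRadius x₀ := (cylRadius_nonneg x₀).lt_of_ne' hx₀
  set δ : ℝ := cylRadius x₀ / 2 with hδ
  have hδ0 : 0 < δ := by positivity
  have hδr : δ < cylRadius x₀ := by rw [hδ]; linarith
  -- `r > r(x₀)/2` on the ball
  have hrad : ∀ x ∈ ball x₀ δ, δ < cylRadius x := by
    intro x hx
    have h1 := cylRadius_le_cylRadius_add_norm_sub x x₀
    have h2 : ‖x₀ - x‖ < δ := by rw [← dist_eq_norm, dist_comm]; exact hx
    rw [hδ] at h2 ⊢
    linarith
  -- the bound `W`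
  obtain ⟨C, hC⟩ := (isCompact_closedBall x₀ δ).exists_bound_of_continuousOn hv.continuousOn
  have hC0 : 0 ≤ C := (norm_nonneg _).trans (hC x₀ (mem_closedBall_self hδ0.le))
  set W : ℝ := C / δ + 1 with hW
  have hW0 : 0 < W := by positivity
  have hηW : ∀ x ∈ ball x₀ δ, ‖curl v x‖ / cylRadius x ≤ W := by
    intro x hx
    have h1 : ‖curl v x‖ / cylRadius x ≤ C / δ :=
      div_le_div₀ hC0 (hC x (ball_subset_closedBall hx)) hδ0 (hrad x hx).le
    rw [hW]
    linarith
  -- the mass: finite …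
  set I : ℝ≥0∞ := ∫⁻ x in ball x₀ δ, ENNReal.ofReal (‖curl v x‖ / cylRadius x) with hI
  have hItop : I ≠ ∞ := by
    have h1 : I ≤ ENNReal.ofReal W * volume (ball x₀ δ) := by
      calc I ≤ ∫⁻ _ in ball x₀ δ, ENNReal.ofReal W :=
            setLIntegral_mono' measurableSet_ball fun x hx => ENNReal.ofReal_le_ofReal (hηW x hx)
        _ = ENNReal.ofReal W * volume (ball x₀ δ) := setLIntegral_const _ _
    exact ne_top_of_le_ne_top (ENNReal.mul_ne_top ENNReal.ofReal_ne_top measure_ball_lt_top.ne) h1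
  -- … and positive (continuity of the density at `x₀`)
  set η₀ : ℝ := ‖curl v x₀‖ / cylRadius x₀ with hη₀
  have hη₀0 : 0 < η₀ := div_pos (norm_pos_iff.2 hc) hr₀
  have hcont : ContinuousAt (fun x => ‖curl v x‖ / cylRadius x) x₀ :=
    (hv.norm.continuousAt).div continuous_cylRadius.continuousAt hx₀
  obtain ⟨ε, hε, hεball⟩ := Metric.continuousAt_iff.1 hcont (η₀ / 2) (by positivity)
  have hI0 : I ≠ 0 := by
    have hlow : ENNReal.ofReal (η₀ / 2) * volume (ball x₀ (min δ ε)) ≤ I := by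
      calc ENNReal.ofReal (η₀ / 2) * volume (ball x₀ (min δ ε))
          = ∫⁻ _ in ball x₀ (min δ ε), ENNReal.ofReal (η₀ / 2) := (setLIntegral_const _ _).symm
        _ ≤ ∫⁻ x in ball x₀ (min δ ε), ENNReal.ofReal (‖curl v x‖ / cylRadius x) := by
            refine setLIntegral_mono' measurableSet_ball fun x hx => ENNReal.ofReal_le_ofReal ?_
            have hd : dist x x₀ < ε := lt_of_lt_of_le (mem_ball.1 hx) (min_le_right _ _)
            have h := hεball hd
            rw [Real.dist_eq, abs_lt] at h
            linarith [h.1]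
        _ ≤ I := lintegral_mono_set (ball_subset_ball (min_le_left _ _))
    have hvol : 0 < volume (ball x₀ (min δ ε)) := measure_ball_pos volume x₀ (lt_min hδ0 hε)
    have hpos : 0 < ENNReal.ofReal (η₀ / 2) * volume (ball x₀ (min δ ε)) :=
      ENNReal.mul_pos (ENNReal.ofReal_pos.2 (by positivity)).ne' hvol.ne'
    exact (hpos.trans_le hlow).ne'
  refine ⟨δ, W, I.toReal, hδ0, hδr, hW0, ENNReal.toReal_pos hI0 hItop, hηW, ?_⟩
  rw [ENNReal.ofReal_toReal hItop]

/-! ### The windowed enstrophy budget of a classical member -/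

/-- **Windowed enstrophy from the `E`-gauge.**  For a classical Euler solution on the past with a weak spatial gradient `H` obeying
`a^ρ E(a) ≤ c` for all `a > 0`: `∫_{−a²}^{0} ∫_{B(0,a)} |curl u(τ,x)|² dx dτ ≤ 16 c a^{1−ρ}` (Tonelli; `|curl u|² ≤ 16 |∇u|²_F`; the gauge on
the classical gradient). [cite: CaffarelliKohnNirenberg1982, §2 (δ(r))] -/
theorem lintegral_window_sq_curl_le {ρ : ℝ} {c : ℝ≥0}
    (hH : HasWeakSpatialGradientOn (slab (EuclideanSpace ℝ (Fin 3)) (Iio 0) isOpen_Iio) u H)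
    (hcl : IsClassicalEulerSolutionOn (Iio 0) 0 u p)
    (hE : ∀ a : ℝ, 0 < a →
      ENNReal.ofReal (a ^ ρ) * cknE a (0 : ℝ × EuclideanSpace ℝ (Fin 3)) H ≤ (c : ℝ≥0∞))
    {a : ℝ} (ha : 0 < a) :
    ∫⁻ τ in Ioo (-a ^ 2) 0, ∫⁻ x in ball (0 : EuclideanSpace ℝ (Fin 3)) a, ENNReal.ofReal (‖curl (u τ) x‖ ^ 2) ≤
      ENNReal.ofReal (16 * ((c : ℝ) * a ^ (1 - ρ))) := by
  -- adapted from …SwirlfreeLedgerDecay (`axisLedgerDecay_of_classical`, Tonelli step)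
  set I : Set ℝ := Ioo (-a ^ 2) 0 with hI
  set B : Set (EuclideanSpace ℝ (Fin 3)) := ball 0 a with hB
  have hQm : MeasurableSet (I ×ˢ B) := measurableSet_Ioo.prod measurableSet_ball
  have hQsub : I ×ˢ B ⊆ Iio (0 : ℝ) ×ˢ (univ : Set (EuclideanSpace ℝ (Fin 3))) :=
    prod_mono Ioo_subset_Iio_self (subset_univ _)
  have hμ : ((volume : Measure ℝ).restrict I).prod ((volume : Measure (EuclideanSpace ℝ (Fin 3))).restrict B) =
      (volume : Measure (ℝ × EuclideanSpace ℝ (Fin 3))).restrict (I ×ˢ B) := by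
    rw [Measure.prod_restrict, ← Measure.volume_eq_prod]
  have hgm : AEMeasurable (uncurry fun (τ : ℝ) (x : EuclideanSpace ℝ (Fin 3)) => ENNReal.ofReal (‖curl (u τ) x‖ ^ 2))
      (((volume : Measure ℝ).restrict I).prod ((volume : Measure (EuclideanSpace ℝ (Fin 3))).restrict B)) := by
    rw [hμ]
    have hcurlm : AEMeasurable (fun z : ℝ × EuclideanSpace ℝ (Fin 3) => curl (u z.1) z.2) (volume.restrict (I ×ˢ B)) :=
      ((continuousOn_curl_slab hcl).mono hQsub).aemeasurable hQm
    exact (hcurlm.norm.pow_const 2).ennreal_ofReal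
  have hTonelli := lintegral_lintegral hgm
  rw [hμ] at hTonelli
  rw [hTonelli]
  calc ∫⁻ z in I ×ˢ B, ENNReal.ofReal (‖curl (u z.1) z.2‖ ^ 2)
      ≤ ∫⁻ z in I ×ˢ B, ENNReal.ofReal 16 * ENNReal.ofReal (frobeniusNormSq (fderiv ℝ (u z.1) z.2)) := by
        refine lintegral_mono fun z => ?_
        rw [← ENNReal.ofReal_mul (by norm_num)]
        exact ENNReal.ofReal_le_ofReal (sq_norm_curl_le_frobeniusNormSq _ _)
    _ = ENNReal.ofReal 16 * ∫⁻ z in I ×ˢ B, ENNReal.ofReal (frobeniusNormSq (fderiv ℝ (u z.1) z.2)) :=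
        lintegral_const_mul' _ _ ENNReal.ofReal_ne_top
    _ ≤ ENNReal.ofReal 16 * ENNReal.ofReal ((c : ℝ) * a ^ (1 - ρ)) := by
        gcongr
        exact setLIntegral_window_frobenius_fderiv_le hH hcl hE ha
    _ = ENNReal.ofReal (16 * ((c : ℝ) * a ^ (1 - ρ))) := by rw [← ENNReal.ofReal_mul (by norm_num)]

/-! ### `log a = o(a^ε)` in the form used -/

/-- For `ε > 0` and any `K`, eventually `K log a < a^ε` (Mathlib `isLittleO_log_rpow_atTop`). [folklore] -/
theorem eventually_mul_log_lt_rpow {ε : ℝ} (hε : 0 < ε) (K : ℝ) :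
    ∀ᶠ a : ℝ in atTop, K * Real.log a < a ^ ε := by
  have hc : (0 : ℝ) < 1 / (2 * (|K| + 1)) := by positivity
  filter_upwards [(isLittleO_log_rpow_atTop hε).def hc, eventually_gt_atTop 1] with a ha ha1
  have hlog : 0 < Real.log a := Real.log_pos ha1
  have hpow : 0 < a ^ ε := Real.rpow_pos_of_pos (by linarith) ε
  rw [Real.norm_of_nonneg hlog.le, Real.norm_of_nonneg hpow.le] at ha
  have h1 : K * Real.log a ≤ |K| * Real.log a := mul_le_mul_of_nonneg_right (le_abs_self K) hlog.le
  have h2 : |K| * Real.log a ≤ |K| * (1 / (2 * (|K| + 1)) * a ^ ε) := mul_le_mul_of_nonneg_left ha (abs_nonneg K)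
  have h3 : |K| * (1 / (2 * (|K| + 1))) ≤ 1 / 2 := by
    rw [← mul_div_assoc, mul_one, div_le_iff₀ (by positivity)]
    nlinarith [abs_nonneg K]
  nlinarith

end Summit.NavierStokesRegularity.NavierStokesRegularity.Theorems.PowerGaugeEulerLiouville.CasimirFloor

end
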